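import Literature.NumberTheory.LFunctions.ThetaChainExtCheck
import HarnessLib

/-!
# Schoenfeld's `θ`-bound on `[599, e¹⁶]` by kernel computation: extended run, chunk 4 of 14
# (plan N2 of provefact `Literature.NumberTheory.LFunctions.robin_iff`)

Topic: `Literature/NumberTheory/LFunctions`. Pure proof file (a kernel computation; nothing is
asserted, no definition). `xrun4` evaluates `ThetaChain.runDExt 20000 60000` — at most `20000`
self-contained steps of the `θ`-chain (`ThetaChain.stepExt`, `ThetaChainExtCheck.lean`: primality of
the next data entry and compositeness of the odd numbers skipped, by gcds with the product of the
odd primes `≤ 2999`; the enclosures of `log p`, `θ(p)`; the two comparisons behind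
`|θ(x) − x| ≤ √x log² x/(8π)`) over the data entries from position `60000` — on the state reached
before (the literal on the left: the prime `5525917` with its enclosures, recorded by
chunk 3) and records the resulting state (the prime `5838397`,
data entry `80000`). Soundness: `ThetaChain.runDExt_sound` (`ThetaChainExtSound.lean`), for
arbitrary data; assembly of the 14 chunks: `ThetaSmallRange.lean`. The expected states were
obtained by evaluating the same function outside the kernel. `decide +kernel`, standard axioms only
(about one minute of kernel time; `maxHeartbeats 0` lifts the deterministic time-out for this one
declaration).

## References

* L. Schoenfeld, *Sharper bounds for the Chebyshev functions θ(x) and ψ(x). II*, Math. Comp. 30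
  (1976), 337–360, Thm. 10 (6.3) and p. 339. [Schoenfeld1976]
-/

namespace Literature.NumberTheory.LFunctions.ThetaChainRun

open ThetaChain

set_option maxHeartbeats 0 in
/-- **Chunk 4 of the extended certified `θ`-run** (data entries `60000` to `80000`, primes
`5525917` to `5838397`). [cite: Schoenfeld1976, Thm. 10 (6.3)] -/
theorem xrun4 :
    runDExt 20000 60000
      ⟨5525917, 18768524707717751156282705, 18768524707718226771414573,
        6677661065323753068461328772580, 6677661065323934960539099413477⟩ =
    some ⟨5838397, 18835024170523347638119275, 18835024170523823253699843,
        7053701841510359360555037235094, 7053701841510550764939930972796⟩ := by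
  decide +kernel

end Literature.NumberTheory.LFunctions.ThetaChainRun
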